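import Literature.Geometry.Kaehler.Kaehler
import HarnessLib

/-!
# Hermitian and Kähler metrics on complex manifolds: proofs

Trunk: Kähler / Hodge (topic `Geometry/Kaehler`); the proofs file of `Kaehler.lean`: the flat
model (§ *The flat model*), and the smoothness of the Kähler form of a smooth metric on a complex
manifold (§ *Smoothness of the Kähler form*, the discharge
`Literature.Geometry.Kaehler.isSmoothForm_kaehlerForm_of_isManifold_complex_holds` of the corrected
named fact of `Kaehler.lean`).

## The flat model

`Bundle.RiemannianMetric.IsKaehler` is a *definition* — Voisin (2002), §3.1.2, Def. 3.6 of the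
English edition (CUP): "the Hermitian metric `h` is Kähler if `I` is integrable and the `2`-form
`ω` is closed", with `ω = -Im h`, `g = Re h`, `g(Iu, Iv) = g(u, v)`, `g(u, v) = ω(u, Iv)`
(Lemma 3.3) — so it has no truth value of its own; it is consumed as a hypothesis
`(hg : g.IsKaehler)`. What is dischargeable in `Kaehler.lean` are the two named facts exhibiting
the definition on the flat model, and they are proved here (D-0014: the `def`s stay, their users
are fed the `_holds` theorems):

* `Literature.Geometry.Kaehler.isKaehler_riemannianMetricVectorSpace_holds`: on a finite-dimensional complex inner product
  space, Mathlib's metric `riemannianMetricVectorSpace` (`g = Re ⟪·, ·⟫`) is Kähler.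
* `Literature.Geometry.Kaehler.isKaehlerManifold_vectorSpace_holds`: a finite-dimensional complex normed space, as a
  complex manifold modelled on itself, is a Kähler manifold (`Literature.IsKaehlerManifold V V`).

## Proof

On a vector space regarded as a manifold modelled on itself the charts are the identity, so the
manifold exterior derivative is Mathlib's `extDeriv` (`Literature.Geometry.Kaehler.mextDeriv_eq_extDeriv`); a metric with
constant coefficients has a *constant* Kähler form, and a constant form is closed
(`fderiv_const_apply`): `isClosedForm_const_vectorSpace`, `isClosedForm_kaehlerForm_of_inner_eq`.
Hermitian-ness is `Re ⟪iv, iw⟫ = Re ⟪v, w⟫` (`re_inner_I_smul_I_smul`). For an arbitrary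
finite-dimensional complex normed space `V` the witness metric is the Euclidean metric of `ℂⁿ`
transported along a `ℂ`-linear homeomorphism `L : V ≃L[ℂ] ℂⁿ` (`n = dim_ℂ V`,
`ContinuousLinearEquiv.ofFinrankEq`), `g(v, w) = Re ⟪Lv, Lw⟫`, a constant — hence smooth
(`contMDiff_totalSpaceMk_bilin_const`, the argument of Mathlib's `riemannianMetricVectorSpace`) —
section. This is the textbook computation `ω = (i/2) Σ dzᵢ ∧ dz̄ᵢ`, `dω = 0` on `ℂⁿ`
(Voisin (2002), §3.1.3, p. 63; Griffiths–Harris (1978), p. 107).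

## Smoothness of the Kähler form

`isSmoothForm_kaehlerForm_of_isManifold_complex_holds` discharges the named fact
`isSmoothForm_kaehlerForm_of_isManifold_complex` of `Kaehler.lean` (Voisin (2002), §3.1.2,
p. 63: for a differentiable Hermitian metric "Lemma 3.3 can be applied with parameters" to give
the real `2`-form `ω = -Im h`): the Kähler form of a `C^∞` Riemannian metric `g` on the real
tangent bundle of a complex manifold `M` (charts in `E`, holomorphic transition maps) is smooth
in the chart-wise sense `IsSmoothForm`. The textbook proof, in Mathlib's language:
* pointwise `ω_x = Φ(g_x)` for one bounded linear — hence `C^∞` — map `Φ` from real bilinear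
  forms on `E` to `2`-forms, `Φ(B)(v, w) = ½ (B(iv, w) - B(iw, v))`
  (`exists_contDiff_kaehlerForm_eq`; `Φ` is the body of `kaehlerForm`, no new definition);
* the coordinate changes of Mathlib's *real* tangent bundle `TangentSpace 𝓘(ℝ, E)` of `M` are
  restrictions of scalars of the complex ones (`tangentCoordChange_eq_restrictScalars`), so the
  inverse trivialization `(trivializationAt E (TangentSpace 𝓘(ℝ, E)) x₀).symmL ℝ x` intertwines
  `i • ·` with `tangentJ E x` (`symmL_trivializationAt_I_smul`; Voisin (2002), §2.2.1: the
  transition maps "have `ℂ`-linear differentials", so the local `1 × i` "glue together");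
* in the chart at `x₀` the derivative of the inverse chart is that inverse trivialization
  (`TangentBundle.symmL_trivializationAt`), which conjugates the coefficient form
  (`trivializationAt_bilinForm_apply₂`); so on the chart target `MForm.inChart ω x₀` is `Φ`
  composed with the coordinate expression of the `C^∞` section `g` (`contMDiffAt_section`,
  `contMDiffAt_iff_source`).
The binder `[FiniteDimensional ℂ E]` of the fact is not used (unconditional form:
`Bundle.ContMDiffRiemannianMetric.isSmoothForm_kaehlerForm_toRiemannianMetric`).

## References

* C. Voisin, *Hodge Theory and Complex Algebraic Geometry I*, Cambridge Studies in Advanced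
  Mathematics 76 (2002), §2.2.1 (p. 44), §3.1.1 Lemma 3.3, §3.1.2 (p. 63) and Def. 3.6,
  §3.1.3 p. 63. [Voisin2002]
* P. Griffiths, J. Harris, *Principles of Algebraic Geometry* (1978), p. 107. [GriffithsHarris1978]
-/

noncomputable section

open scoped Manifold ContDiff Topology
open Bundle

namespace Literature.Geometry.Kaehler

section FlatProofs

variable {V : Type*} [NormedAddCommGroup V]

/-- On a real normed space regarded as a manifold modelled on itself, a constant `k`-form is
closed: its exterior derivative is Mathlib's `extDeriv` (`mextDeriv_eq_extDeriv`), and the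
derivative of a constant vanishes (`fderiv_const_apply`). [folklore] -/
theorem isClosedForm_const_vectorSpace [NormedSpace ℝ V] {F : Type*} [NormedAddCommGroup F]
    [NormedSpace ℝ F] {k : ℕ} (c : V [⋀^Fin k]→L[ℝ] F) :
    IsClosedForm (I := 𝓘(ℝ, V)) (M := V) (F := F) (k := k) fun _ ↦ c := by
  funext x
  rw [mextDeriv_eq_extDeriv, extDeriv, fderiv_const_apply,
    ← ContinuousAlternatingMap.alternatizeUncurryFinCLM_apply, map_zero]
  rfl

/-- On a real normed space regarded as a manifold modelled on itself, a *constant* field of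
continuous bilinear forms `x ↦ B` is a `C^∞` section of the bundle of bilinear forms on the
tangent bundle (the trivialisations of the tangent bundle of a model space are the identity; same
argument as Mathlib's `riemannianMetricVectorSpace`). [folklore] -/
theorem contMDiff_totalSpaceMk_bilin_const [NormedSpace ℝ V] (B : V →L[ℝ] V →L[ℝ] ℝ) :
    ContMDiff 𝓘(ℝ, V) (𝓘(ℝ, V).prod 𝓘(ℝ, V →L[ℝ] V →L[ℝ] ℝ)) ∞
      (fun x : V ↦ TotalSpace.mk' (V →L[ℝ] V →L[ℝ] ℝ)
        (E := fun y : V ↦ TangentSpace 𝓘(ℝ, V) y →L[ℝ] TangentSpace 𝓘(ℝ, V) y →L[ℝ] ℝ) x B) := by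
  intro x
  rw [contMDiffAt_section]
  convert! contMDiffAt_const (c := B)
  ext v w
  rw [hom_trivializationAt_apply]
  simp only [ContinuousLinearMap.inCoordinates]
  simp
  rw [hom_trivializationAt_apply]
  simp [ContinuousLinearMap.inCoordinates]
  rfl

/-- The real part of a complex inner product is invariant under the complex structure:
`Re ⟪i v, i w⟫ = Re ⟪v, w⟫` (Voisin (2002), §3.1.1, proof of Lemma 3.3: `h(Iu, Iv) = h(u, v)`
and `g = Re h`). [cite: Voisin2002, §3.1.1 Lemma 3.3] -/
theorem re_inner_I_smul_I_smul {W : Type*} [NormedAddCommGroup W] [InnerProductSpace ℂ W]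
    (v w : W) :
    RCLike.re (inner ℂ (Complex.I • v) (Complex.I • w)) = RCLike.re (inner ℂ v w) := by
  rw [inner_smul_left, inner_smul_right, ← mul_assoc, Complex.conj_I, neg_mul, Complex.I_mul_I,
    neg_neg, one_mul]

variable [NormedSpace ℂ V]

/-- On a complex normed space regarded as a complex manifold modelled on itself, the Kähler form
of a Riemannian metric with constant coefficients (`g_x = g_0` for all `x`) is closed: it is a
constant `2`-form on the model space (`isClosedForm_const_vectorSpace`). This is the computation
`ω = (i/2) Σ dzᵢ ∧ dz̄ᵢ`, `dω = 0` on `ℂⁿ` (Voisin (2002), §3.1.3, p. 63; Griffiths–Harris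
(1978), p. 107). [cite: Voisin2002, §3.1.3 p. 63] -/
theorem isClosedForm_kaehlerForm_of_inner_eq
    (g : RiemannianMetric (fun x : V ↦ TangentSpace 𝓘(ℝ, V) x))
    (hg : ∀ x : V, g.inner x = g.inner 0) : IsClosedForm g.kaehlerForm := by
  have h : g.kaehlerForm = fun _ ↦ g.kaehlerForm 0 := by
    funext x
    simp only [Bundle.RiemannianMetric.kaehlerForm]
    rw [hg x]
    rfl
  rw [h]
  exact isClosedForm_const_vectorSpace _

/-- **Discharge** of the named fact `isKaehler_riemannianMetricVectorSpace` (the flat model is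
Kähler): Mathlib's metric `g = Re ⟪·, ·⟫` (`riemannianMetricVectorSpace`) on a
finite-dimensional complex inner product space is Hermitian (`re_inner_I_smul_I_smul`), and its
Kähler form has constant coefficients, hence is closed (`isClosedForm_kaehlerForm_of_inner_eq`).
Voisin (2002), §3.1.2, Def. 3.6, and §3.1.3, p. 63 (`ℂⁿ`, `ω = (i/2) Σ dzᵢ ∧ dz̄ᵢ`);
Griffiths–Harris (1978), p. 107. [cite: Voisin2002, §3.1.2 Def. 3.6] -/
theorem isKaehler_riemannianMetricVectorSpace_holds : isKaehler_riemannianMetricVectorSpace := by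
  intro V _ _ _
  letI : InnerProductSpace ℝ V := InnerProductSpace.complexToReal
  refine ⟨fun x v w ↦ ?_, isClosedForm_kaehlerForm_of_inner_eq _ fun _ ↦ rfl⟩
  change RCLike.re (inner ℂ (Complex.I • (show V from v)) (Complex.I • (show V from w))) =
    RCLike.re (inner ℂ (show V from v) (show V from w))
  exact re_inner_I_smul_I_smul _ _

/-- **Discharge** of the named fact `isKaehlerManifold_vectorSpace`: a finite-dimensional complex
normed space `V`, as a complex manifold modelled on itself, is a Kähler manifold. Witness: fix a
`ℂ`-linear homeomorphism `L : V ≃L[ℂ] ℂⁿ` (`n = dim_ℂ V`, `ℂⁿ = EuclideanSpace ℂ (Fin n)`,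
`ContinuousLinearEquiv.ofFinrankEq`) and take the constant metric `g(v, w) = Re ⟪L v, L w⟫`,
i.e. the Euclidean metric of `ℂⁿ` transported to `V`; it is smooth
(`contMDiff_totalSpaceMk_bilin_const`), Hermitian since `L` commutes with `i`
(`re_inner_I_smul_I_smul`), and its Kähler form is constant, hence closed
(`isClosedForm_kaehlerForm_of_inner_eq`). Griffiths–Harris (1978), p. 107 (`ℂⁿ` with the
Euclidean metric is Kähler); Voisin (2002), §3.1.2, Def. 3.6. [cite: GriffithsHarris1978, p. 107] -/
theorem isKaehlerManifold_vectorSpace_holds : isKaehlerManifold_vectorSpace := by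
  intro V _ _ _
  -- the comparison map with `ℂⁿ` and the transported Euclidean metric `B`
  let W : Type := EuclideanSpace ℂ (Fin (Module.finrank ℂ V))
  letI : InnerProductSpace ℝ W := InnerProductSpace.complexToReal
  let L : V ≃L[ℂ] W := ContinuousLinearEquiv.ofFinrankEq finrank_euclideanSpace_fin.symm
  let L' : V →L[ℝ] W := (L : V →L[ℂ] W).restrictScalars ℝ
  let B : V →L[ℝ] V →L[ℝ] ℝ := (innerSL ℝ (E := W)).bilinearComp L' L'
  have hB : ∀ v w : V, B v w = RCLike.re (inner ℂ (L v) (L w)) := fun v w ↦ rfl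
  have hBself : ∀ v : V, B v v = ‖L v‖ ^ 2 := fun v ↦ by
    rw [hB, ← norm_sq_eq_re_inner]
  let g : ContMDiffRiemannianMetric 𝓘(ℝ, V) ∞ V (fun x : V ↦ TangentSpace 𝓘(ℝ, V) x) :=
    { inner := fun _ ↦ B
      symm := fun _ v w ↦ by
        change B v w = B w v
        rw [hB, hB, ← inner_conj_symm, RCLike.conj_re]
      pos := fun _ v hv ↦ by
        change 0 < B v v
        rw [hBself]
        exact pow_pos (norm_pos_iff.2 (L.map_ne_zero_iff.2 hv)) 2
      isVonNBounded := fun _ ↦ by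
        -- `{v | ‖L v‖² < 1}` lies in the closed ball of radius `‖L⁻¹‖`
        change Bornology.IsVonNBounded ℝ {v : V | B v v < 1}
        refine (NormedSpace.isVonNBounded_closedBall ℝ V ‖(L.symm : W →L[ℂ] V)‖).subset ?_
        intro v hv
        rw [Set.mem_setOf_eq, hBself, sq_lt_one_iff₀ (norm_nonneg _)] at hv
        rw [Metric.mem_closedBall, dist_zero_right]
        calc ‖v‖ = ‖(L.symm : W →L[ℂ] V) (L v)‖ := by simp
          _ ≤ ‖(L.symm : W →L[ℂ] V)‖ * ‖L v‖ := ContinuousLinearMap.le_opNorm _ _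
          _ ≤ ‖(L.symm : W →L[ℂ] V)‖ := mul_le_of_le_one_right (norm_nonneg _) hv.le
      contMDiff := contMDiff_totalSpaceMk_bilin_const B }
  refine ⟨⟨g, fun x v w ↦ ?_, isClosedForm_kaehlerForm_of_inner_eq _ fun _ ↦ rfl⟩⟩
  change B (Complex.I • (show V from v)) (Complex.I • (show V from w)) = B v w
  rw [hB, hB, map_smul, map_smul]
  exact re_inner_I_smul_I_smul _ _

end FlatProofs

/-! ### Smoothness of the Kähler form -/

section ModelForm

variable {E : Type*} [NormedAddCommGroup E] [NormedSpace ℂ E]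
  {M : Type*} [TopologicalSpace M] [ChartedSpace E M]

/-- **The Kähler form is a smooth function of the coefficient form** (pointwise linear algebra).
There is a map `Φ` from continuous real bilinear forms on the complex normed space `E` to
continuous alternating `2`-forms on `E` which is `C^∞` (indeed bounded linear, `‖Φ(B)‖ ≤ ‖B‖`),
is given by `Φ(B)(v₀, v₁) = ½ (B(i v₀, v₁) - B(i v₁, v₀))`, and computes the Kähler form of every
Riemannian metric `g` on the real tangent bundle of a manifold modelled on `E`: `ω_x = Φ(g_x)`
(definitional: `Φ` is the body of `Bundle.RiemannianMetric.kaehlerForm`, `½ · Alt (B(J·, ·))`).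
Voisin (2002), §3.1.1 (Lemma 3.3: `ω = -Im h`, `g = Re h`). [cite: Voisin2002, §3.1.1 Lemma 3.3] -/
theorem exists_contDiff_kaehlerForm_eq :
    ∃ Φ : (E →L[ℝ] E →L[ℝ] ℝ) → E [⋀^Fin 2]→L[ℝ] ℝ,
      ContDiff ℝ ∞ Φ ∧
      (∀ (B : E →L[ℝ] E →L[ℝ] ℝ) (v : Fin 2 → E),
        Φ B v = 2⁻¹ * (B (Complex.I • v 0) (v 1) - B (Complex.I • v 1) (v 0))) ∧
      ∀ (g : RiemannianMetric (fun x : M ↦ TangentSpace 𝓘(ℝ, E) x)) (x : M),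
        g.kaehlerForm x = Φ (g.inner x) := by
  let J : E →L[ℝ] E := (Complex.I • ContinuousLinearMap.id ℂ E).restrictScalars ℝ
  let Φ : (E →L[ℝ] E →L[ℝ] ℝ) → E [⋀^Fin 2]→L[ℝ] ℝ := fun B ↦
    (2⁻¹ : ℝ) • ContinuousMultilinearMap.alternatization
      (ContinuousLinearMap.uncurryLeft
        (((continuousMultilinearCurryFin1 ℝ E ℝ).symm : (E →L[ℝ] ℝ) →L[ℝ] _).comp (B.comp J)))
  have hΦa : ∀ (B : E →L[ℝ] E →L[ℝ] ℝ) (v : Fin 2 → E),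
      Φ B v = 2⁻¹ * (B (Complex.I • v 0) (v 1) - B (Complex.I • v 1) (v 0)) := by
    intro B v
    simp only [Φ, ContinuousAlternatingMap.smul_apply,
      ContinuousMultilinearMap.alternatization_apply_apply]
    have huniv : (Finset.univ : Finset (Equiv.Perm (Fin 2))) = {1, Equiv.swap 0 1} := by decide
    rw [huniv, Finset.sum_pair (by decide)]
    simp [Equiv.Perm.sign_swap', Units.smul_def, sub_eq_add_neg, J, Fin.tail]
  refine ⟨Φ, ?_, hΦa, fun g x ↦ rfl⟩
  -- `Φ` is a bounded linear map, hence smooth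
  refine IsBoundedLinearMap.contDiff ⟨⟨fun B B' ↦ ?_, fun c B ↦ ?_⟩, 1, one_pos, fun B ↦ ?_⟩
  · ext v
    simp only [hΦa, ContinuousAlternatingMap.add_apply, add_apply]
    ring
  · ext v
    simp only [hΦa, ContinuousAlternatingMap.smul_apply, smul_apply, smul_eq_mul]
    ring
  · rw [one_mul]
    refine ContinuousAlternatingMap.opNorm_le_bound _ (norm_nonneg B) fun v ↦ ?_
    rw [hΦa, Fin.prod_univ_two, norm_mul, norm_inv, Real.norm_two]
    have h0 := B.le_opNorm₂ (Complex.I • v 0) (v 1)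
    have h1 := B.le_opNorm₂ (Complex.I • v 1) (v 0)
    rw [norm_smul, Complex.norm_I, one_mul] at h0 h1
    have h2 := norm_sub_le (B (Complex.I • v 0) (v 1)) (B (Complex.I • v 1) (v 0))
    nlinarith [norm_nonneg (v 0), norm_nonneg (v 1), norm_nonneg B]

end ModelForm

section ComplexStructure

variable {E : Type*} [NormedAddCommGroup E] [NormedSpace ℂ E]
  {M : Type*} [TopologicalSpace M] [ChartedSpace E M]
  [IsManifold 𝓘(ℝ, E) ∞ M] [IsManifold 𝓘(ℂ, E) ω M]

/-- **Holomorphic coordinate changes have `ℂ`-linear differentials.** On a complex manifold `M`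
(charts valued in `E`, holomorphic transition maps), regarded as a real `C^∞` manifold with the
same charts, the coordinate change `tangentCoordChange 𝓘(ℝ, E) x y z` of Mathlib's real tangent
bundle — the real derivative of the transition map `φ_y ∘ φ_x⁻¹` at `φ_x z` — is the restriction
of scalars of the complex one (the two extended charts are the same partial equivalence, and a
`ℂ`-derivative restricts to the `ℝ`-derivative, `HasFDerivWithinAt.restrictScalars`). Voisin
(2002), §2.2.1 (p. 44: "the change of chart morphisms `φⱼ ∘ φᵢ⁻¹` are holomorphic by
hypothesis, i.e. have `ℂ`-linear differentials"). [cite: Voisin2002, §2.2.1] -/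
theorem tangentCoordChange_eq_restrictScalars {x y z : M}
    (h : z ∈ (extChartAt 𝓘(ℂ, E) x).source ∩ (extChartAt 𝓘(ℂ, E) y).source) :
    tangentCoordChange 𝓘(ℝ, E) x y z = (tangentCoordChange 𝓘(ℂ, E) x y z).restrictScalars ℝ := by
  have hC := (hasFDerivWithinAt_tangentCoordChange (I := 𝓘(ℂ, E)) h).restrictScalars ℝ
  have hR := hasFDerivWithinAt_tangentCoordChange (I := 𝓘(ℝ, E)) h
  simp only [ModelWithCorners.Boundaryless.range_eq_univ] at hR hC
  exact uniqueDiffWithinAt_univ.eq hR hC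

/-- **The complex structure `J` is respected by the tangent bundle trivializations of a complex
manifold.** For `x` in the chart domain of `x₀`, the inverse trivialization at `x₀` of Mathlib's
real tangent bundle, `(trivializationAt E (TangentSpace 𝓘(ℝ, E)) x₀).symmL ℝ x : E →L[ℝ] T_x M`
(the tangent coordinate change from the chart at `x₀` to the chart at `x`), intertwines `i • ·`
on the model fibre with `tangentJ E x`: the local operators `1 × i` "glue together on `Uᵢ ∩ Uⱼ`
and define a global endomorphism `I` of `T_{X,ℝ}`" (Voisin (2002), §2.2.1, p. 44). From
`tangentCoordChange_eq_restrictScalars`. [cite: Voisin2002, §2.2.1] -/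
theorem symmL_trivializationAt_I_smul {x₀ x : M} (hx : x ∈ (chartAt E x₀).source) (v : E) :
    (trivializationAt E (TangentSpace 𝓘(ℝ, E)) x₀).symmL ℝ x (Complex.I • v) =
      tangentJ E x ((trivializationAt E (TangentSpace 𝓘(ℝ, E)) x₀).symmL ℝ x v) := by
  rw [tangentJ_apply, TangentBundle.symmL_trivializationAt_eq_core hx]
  have hx' : x ∈ (extChartAt 𝓘(ℂ, E) x₀).source ∩ (extChartAt 𝓘(ℂ, E) x).source := by
    simp only [extChartAt_source]
    exact ⟨hx, mem_chart_source E x⟩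
  have key := tangentCoordChange_eq_restrictScalars (E := E) (M := M) hx'
  rw [tangentCoordChange] at key
  rw [key]
  exact (tangentCoordChange 𝓘(ℂ, E) x₀ x x).map_smul Complex.I v

end ComplexStructure

section BilinFormBundle

variable {EM : Type*} [NormedAddCommGroup EM] [NormedSpace ℝ EM] {HM : Type*}
  [TopologicalSpace HM] {I : ModelWithCorners ℝ EM HM}
  {M : Type*} [TopologicalSpace M] [ChartedSpace HM M] [IsManifold I 1 M]

/-- **Trivialization of the bundle of bilinear forms on the tangent bundle.** For a real `C¹`
manifold `M`, the trivialization at `x₀` of Mathlib's vector bundle `x ↦ T_x M →L[ℝ] T_x M →L[ℝ] ℝ`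
(an iterated `Bundle.ContinuousLinearMap` bundle, the home of `Bundle.ContMDiffRiemannianMetric`)
sends a form `G` over `x` to its conjugate `(v, w) ↦ G (ψ v) (ψ w)` by the inverse tangent
trivialization `ψ = (trivializationAt EM (TangentSpace I) x₀).symmL ℝ x` (both sides vanish off
the chart domain of `x₀`). Unfolding of `hom_trivializationAt_apply` / `inCoordinates` twice,
the innermost bundle `Bundle.Trivial M ℝ` being trivialized by the identity. [folklore] -/
theorem trivializationAt_bilinForm_apply₂ (x₀ x : M)
    (G : TangentSpace I x →L[ℝ] TangentSpace I x →L[ℝ] ℝ) (v w : EM) :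
    (trivializationAt (EM →L[ℝ] EM →L[ℝ] ℝ)
        (fun x : M ↦ TangentSpace I x →L[ℝ] TangentSpace I x →L[ℝ] ℝ) x₀ ⟨x, G⟩).2 v w =
      G ((trivializationAt EM (TangentSpace I) x₀).symmL ℝ x v)
        ((trivializationAt EM (TangentSpace I) x₀).symmL ℝ x w) := by
  rw [hom_trivializationAt_apply]
  simp only [ContinuousLinearMap.inCoordinates, ContinuousLinearMap.coe_comp, Function.comp_apply]
  by_cases hx : x ∈ (chartAt HM x₀).source
  · rw [Trivialization.continuousLinearMapAt_apply_of_mem]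
    · rw [hom_trivializationAt_apply]
      simp [ContinuousLinearMap.inCoordinates]
    · simpa using hx
  · simp [hx]

end BilinFormBundle

section SmoothKaehlerForm

variable {E : Type*} [NormedAddCommGroup E] [NormedSpace ℂ E]
  {M : Type*} [TopologicalSpace M] [ChartedSpace E M] [IsManifold 𝓘(ℝ, E) ∞ M]

/-- **The Kähler form of a smooth Riemannian metric on a complex manifold is a smooth `2`-form**
(unconditional form; deliberate dot-notation extension of Mathlib's
`Bundle.ContMDiffRiemannianMetric`, like `kaehlerClass` in `Kaehler.lean`; named literally after
its conclusion `IsSmoothForm g.toRiemannianMetric.kaehlerForm`, the bare short name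
`isSmoothForm_kaehlerForm` being that of the retired mis-stated named fact of `Kaehler.lean`).
For a `C^∞` metric
`g` on the real tangent bundle of a complex manifold `M` (charts in `E`, holomorphic transition
maps; no finite-dimensionality needed), `g.toRiemannianMetric.kaehlerForm` is smooth in the
chart-wise sense `IsSmoothForm`: on the target of the chart `φ` at `x₀` its representative is
`Φ ∘ ĝ ∘ φ⁻¹` (`Φ` from `exists_contDiff_kaehlerForm_eq`, `ĝ` the coordinate expression of the
`C^∞` section `g` at `x₀`), because the derivative of `φ⁻¹` is the inverse tangent
trivialization (`TangentBundle.symmL_trivializationAt`), which conjugates the coefficient form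
(`trivializationAt_bilinForm_apply₂`) and commutes with `J` (`symmL_trivializationAt_I_smul` —
where holomorphy of the transition maps enters). Voisin (2002), §3.1.2 (p. 63: "Lemma 3.3 can be
applied with parameters" to give the real `2`-form `ω = -Im h ∈ Ω^{1,1}_M ∩ Ω²_{M,ℝ}`);
Griffiths–Harris (1978), p. 106. [cite: Voisin2002, §3.1.2] -/
theorem _root_.Bundle.ContMDiffRiemannianMetric.isSmoothForm_kaehlerForm_toRiemannianMetric
    [IsManifold 𝓘(ℂ, E) ω M]
    (g : ContMDiffRiemannianMetric 𝓘(ℝ, E) ∞ E (fun x : M ↦ TangentSpace 𝓘(ℝ, E) x)) :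
    IsSmoothForm g.toRiemannianMetric.kaehlerForm := by
  intro x₀
  obtain ⟨Φ, hΦd, hΦa, hΦg⟩ := exists_contDiff_kaehlerForm_eq (E := E) (M := M)
  -- the coordinate expression `ĝ ∘ φ⁻¹` of the section `g` at `x₀` is `C^∞` at `φ x₀`
  have h1 : ContDiffWithinAt ℝ ∞
      ((fun x ↦ (trivializationAt (E →L[ℝ] E →L[ℝ] ℝ)
        (fun x : M ↦ TangentSpace 𝓘(ℝ, E) x →L[ℝ] TangentSpace 𝓘(ℝ, E) x →L[ℝ] ℝ) x₀
          ⟨x, g.inner x⟩).2) ∘ (extChartAt 𝓘(ℝ, E) x₀).symm)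
      (Set.range 𝓘(ℝ, E)) (extChartAt 𝓘(ℝ, E) x₀ x₀) :=
    contMDiffWithinAt_iff_contDiffWithinAt.1
      (contMDiffAt_iff_source.1 ((contMDiffAt_section x₀).1 (g.contMDiff x₀)))
  -- on the chart target, the chart representative of `ω` is `Φ ∘ ĝ ∘ φ⁻¹`
  have hev : ∀ y ∈ (extChartAt 𝓘(ℝ, E) x₀).target,
      (g.toRiemannianMetric.kaehlerForm).inChart x₀ y =
        (Φ ∘ ((fun x ↦ (trivializationAt (E →L[ℝ] E →L[ℝ] ℝ)
          (fun x : M ↦ TangentSpace 𝓘(ℝ, E) x →L[ℝ] TangentSpace 𝓘(ℝ, E) x →L[ℝ] ℝ) x₀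
            ⟨x, g.inner x⟩).2) ∘ (extChartAt 𝓘(ℝ, E) x₀).symm)) y := by
    intro y hy
    have hx : (extChartAt 𝓘(ℝ, E) x₀).symm y ∈ (chartAt E x₀).source := by
      rw [← extChartAt_source 𝓘(ℝ, E)]
      exact (extChartAt 𝓘(ℝ, E) x₀).map_target hy
    -- the derivative of `φ⁻¹` at `y` is the inverse tangent trivialization at `φ⁻¹ y`
    have hD : mfderivWithin 𝓘(ℝ, E) 𝓘(ℝ, E) (extChartAt 𝓘(ℝ, E) x₀).symm (Set.range 𝓘(ℝ, E)) y =
        (trivializationAt E (TangentSpace 𝓘(ℝ, E)) x₀).symmL ℝ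
          ((extChartAt 𝓘(ℝ, E) x₀).symm y) := by
      rw [TangentBundle.symmL_trivializationAt hx, (extChartAt 𝓘(ℝ, E) x₀).right_inv hy]
    ext v
    simp only [Function.comp_apply, MForm.inChart_apply]
    rw [hΦg, hΦa, trivializationAt_bilinForm_apply₂, trivializationAt_bilinForm_apply₂,
      symmL_trivializationAt_I_smul hx, symmL_trivializationAt_I_smul hx, hD]
    exact (hΦa _ _).trans rfl
  refine (hΦd.contDiffAt.comp_contDiffWithinAt _ h1).congr_of_eventuallyEq ?_
    (hev _ (mem_extChartAt_target x₀))
  exact Filter.eventuallyEq_of_mem (extChartAt_target_mem_nhdsWithin x₀) hev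

/-- **Discharge** of the named fact `isSmoothForm_kaehlerForm_of_isManifold_complex` of
`Kaehler.lean` (the corrected statement of the M5 rewrite's mis-stated, retired named fact
`Literature.Geometry.Kaehler.isSmoothForm_kaehlerForm`, see *Correction* in `Kaehler.lean`):
on a complex manifold `M` modelled on the finite-dimensional complex normed space `E`, the Kähler
form of every `C^∞` Riemannian metric on the real tangent bundle is a smooth `2`-form. Immediate
from `Bundle.ContMDiffRiemannianMetric.isSmoothForm_kaehlerForm_toRiemannianMetric`; the binder
`[FiniteDimensional ℂ E]` is not used (kept in the fact to match `IsKaehlerManifold`). Consumers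
`(h : isSmoothForm_kaehlerForm_of_isManifold_complex)` (`kaehlerClass`, `HodgeDecomposition.lean`)
are fed this theorem. Voisin (2002), §3.1.2 (p. 63); Griffiths–Harris (1978), p. 106.
[cite: Voisin2002, §3.1.2] -/
theorem isSmoothForm_kaehlerForm_of_isManifold_complex_holds [FiniteDimensional ℂ E]
    [IsManifold 𝓘(ℂ, E) ω M] : isSmoothForm_kaehlerForm_of_isManifold_complex (E := E) (M := M) :=
  fun g ↦ g.isSmoothForm_kaehlerForm_toRiemannianMetric

end SmoothKaehlerForm

end Literature.Geometry.Kaehler
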